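import Summits.Parity.GeneralizedHardyLittlewood.Theorems.ArtinGenericSplitNecessityDicksonLower
import Summits.Parity.Statement
import Summits.Parity.GeneralizedHardyLittlewood.Theses.ArtinGenericSplit
import Literature.NumberTheory.Multiplicative.ArtinPrimitiveRootProgressions
import Summits.Parity.GeneralizedHardyLittlewood.Theorems.ShiftedPrimeFactorNecessity

/-!
# Route `ArtinGenericSplit` — necessity package, part 3: `FixedLower ⟺ ArtinTwo ∧ ArtinLift` on the born decls

Cell kernel by decomp-parity lens-2 g6 (HOME/decomp-parity-lens-2/g6/ArtinGenericSplit.lean @5480cd22e7b9287d), critic CLEARED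
HOME/STATUS.md l.255 / CRITIC-LEDGER row 54 (precision P1: «land §5–§7 as a Theorems hand --supports stmt-Parity-26863»);
route born rev 0 (commit 5231dbe0a256, STATUS l.300).  Landed verbatim (re-namespaced, definitions in the sibling Defs file) by
the cell's prover-class hand seat.

This file (§2–§4, §6–§9 of the kernel) ON THE BORN DECLS `Theses.ArtinGenericSplit.ArtinTwo` (stmt-Parity-30686) /
`ArtinLift` (stmt-Parity-30687) and the record leaf `Theses.SiegelSpectrumSplit.FixedLower` (stmt-Parity-26863):
special-vs-generic exhaustion (`isArtinPrime_iff_not_isSpecial`, `artinTwo_iff_generic`); the structured certificates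
`isArtinPrime_of_four_mul_add_one` (q ≥ 3, 4q+1 both prime ⟹ 2 is a primitive root mod 4q+1) and `isArtinPrime_nineteen`;
NECESSITY `artinTwo_of_dickson`, `artinTwo_of_fixedLower : FixedLower → ArtinTwo` (edge 26863 → 30686),
`fourMulAddOne_infinite_of_fixedLower`, `artinTwo_of_ghl`, `artinTwo_of_parity` (hypothesis-free), `artinTwo_of_batemanHorn`
(modulo BH → Dickson); the ERH certificate `artinTwo_of_ERH` through the tree's named fact
`lenstra1977_exists_prime_two_primitiveRoot_progression_of_ERH`; EXACTNESS `fixedLower_iff : FixedLower ↔ ArtinTwo ∧ ArtinLift`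
and `node_iff` through the route's gate-written `closes`.  `fixedLower_of_ghl` / `fixedUpper_of_ghl` / `affLinSize_anti` are REUSED from the sibling
notch's landed necessity file `Theorems/ShiftedPrimeFactorNecessity.lean` (dedup by reuse).
-/

open scoped BigOperators ArithmeticFunction.vonMangoldt Chebyshev
open Finset Filter MeasureTheory Literature.NumberTheory.Sieve

namespace Summit.Parity.GeneralizedHardyLittlewood.ArtinGenericSplitNecessity

open Summit.Parity.GeneralizedHardyLittlewood.Theses.SiegelSpectrumSplit (FixedLower)
open Summit.Parity.GeneralizedHardyLittlewood.Theses.ArtinGenericSplit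
  (ArtinTwo ArtinLift BoundedSiegelZeroQuality FixedUpper UniformUpperGivenFixed UniformLowerGivenFixed closes)

/-- **Exhaustion / dichotomy.** An odd prime is either special or an Artin prime (generic), and not
both. [folklore] -/
theorem isArtinPrime_iff_not_isSpecial {p : ℕ} (hp : p.Prime) (hp2 : p ≠ 2) :
    IsArtinPrime p ↔ ¬ IsSpecial p := by
  haveI := Fact.mk hp
  have h2 : (2 : ZMod p) ≠ 0 := (by
    intro h
    have : ((2 : ℕ) : ZMod p) = 0 := by exact_mod_cast h
    rw [ZMod.natCast_eq_zero_iff] at this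
    exact hp2 ((Nat.prime_dvd_prime_iff_eq hp Nat.prime_two).mp this))
  have hp1 : 0 < p - 1 := by have := hp.two_le; omega
  constructor
  · rintro ⟨-, hord⟩ ⟨ℓ, hℓ, hℓd, hpow⟩
    have hlt : (p - 1) / ℓ < p - 1 := Nat.div_lt_self hp1 hℓ.one_lt
    have hpos : 0 < (p - 1) / ℓ := Nat.div_pos (Nat.le_of_dvd hp1 hℓd) hℓ.pos
    exact pow_ne_one_of_lt_orderOf hpos.ne' (hord ▸ hlt) hpow
  · intro h
    refine ⟨hp, orderOf_eq_of_pow_and_pow_div_prime hp1 (ZMod.pow_card_sub_one_eq_one h2) ?_⟩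
    intro ℓ hℓ hℓd hpow
    exact h ⟨ℓ, hℓ, hℓd, hpow⟩

/-- `2` is not an Artin prime (`(2 : ℤ/2) = 0` has order `0`). [folklore] -/
theorem not_isArtinPrime_two : ¬ IsArtinPrime 2 := by
  rintro ⟨-, h⟩
  have h0 : (2 : ZMod 2) = 0 := by decide
  rw [h0, orderOf_eq_zero_iff'.mpr (fun n hn => by rw [zero_pow (by omega)]; exact zero_ne_one)] at h
  omega

/-- **The piece is «the generic class is infinite»** (lens 2 made literal): Artin primes are exactly
the odd primes that are not special. [this node] -/
theorem artinTwo_iff_generic :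
    ArtinTwo ↔ {p : ℕ | p.Prime ∧ p ≠ 2 ∧ ¬ IsSpecial p}.Infinite := by
  have hset : {p : ℕ | p.Prime ∧ orderOf (2 : ZMod p) = p - 1} = {p : ℕ | p.Prime ∧ p ≠ 2 ∧ ¬ IsSpecial p} := by
    ext p
    simp only [Set.mem_setOf_eq]
    constructor
    · intro h
      have hp2 : p ≠ 2 := by rintro rfl; exact not_isArtinPrime_two h
      exact ⟨h.1, hp2, (isArtinPrime_iff_not_isSpecial h.1 hp2).mp h⟩
    · rintro ⟨hp, hp2, hs⟩
      exact (isArtinPrime_iff_not_isSpecial hp hp2).mpr hs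
  show Set.Infinite _ ↔ _
  rw [hset]

/-! ## §3 The structured witnesses: primes `p = 4q + 1` with `q` prime are Artin primes -/

/-- If `q ≥ 3` and `p = 4q + 1` are primes then `2` is a primitive root mod `p`
(`p ≡ 5 (mod 8)` makes `2` a non-residue, so `2^{2q} = -1`; and `2^4 = 16 ≠ 1`).
[cite: CojocaruMurty2005, §10.4, Exercise 5, p. 198] -/
theorem isArtinPrime_of_four_mul_add_one {q : ℕ} (hq : q.Prime) (hq3 : 3 ≤ q)
    (hp : (4 * q + 1).Prime) : IsArtinPrime (4 * q + 1) := by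
  have hqodd : q % 2 = 1 := by
    rcases Nat.Prime.eq_two_or_odd hq with h | h
    · omega
    · exact h
  generalize hpdef : 4 * q + 1 = p at hp ⊢
  haveI := Fact.mk hp
  have hp8 : p % 8 = 5 := by omega
  have hp2 : p ≠ 2 := by omega
  have h2ne : (2 : ZMod p) ≠ 0 := (by
    intro h
    have : ((2 : ℕ) : ZMod p) = 0 := by exact_mod_cast h
    rw [ZMod.natCast_eq_zero_iff] at this
    exact hp2 ((Nat.prime_dvd_prime_iff_eq hp Nat.prime_two).mp this))
  refine ⟨hp, ?_⟩
  have hp1 : p - 1 = 4 * q := by omega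
  rw [hp1]
  refine orderOf_eq_of_pow_and_pow_div_prime (by omega) ?_ ?_
  · have := ZMod.pow_card_sub_one_eq_one h2ne
    rwa [hp1] at this
  · intro ℓ hℓ hℓd
    have hcases : ℓ = 2 ∨ ℓ = q := by
      rcases (Nat.Prime.dvd_mul hℓ).mp hℓd with h | h
      · left
        have h4 : ℓ ∣ 2 * 2 := by simpa using h
        rcases (Nat.Prime.dvd_mul hℓ).mp h4 with h' | h' <;>
          exact (Nat.prime_dvd_prime_iff_eq hℓ Nat.prime_two).mp h'
      · right
        exact (Nat.prime_dvd_prime_iff_eq hℓ hq).mp h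
    rcases hcases with rfl | rfl
    · -- `2^{2q} = 2^{p/2} ≠ 1` since `2` is not a square mod `p ≡ 5 (mod 8)`
      have hdiv : 4 * q / 2 = p / 2 := by omega
      rw [hdiv]
      intro hsq
      have : IsSquare (2 : ZMod p) := (ZMod.euler_criterion p h2ne).mpr hsq
      rcases (ZMod.exists_sq_eq_two_iff hp2).mp this with h | h <;> omega
    · -- `2^4 = 16 ≠ 1` since `p ∤ 15`
      have hdiv : 4 * ℓ / ℓ = 4 := Nat.mul_div_cancel 4 hℓ.pos
      rw [hdiv]
      intro h16
      have h15 : ((15 : ℕ) : ZMod p) = 0 := by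
        have h' : ((15 : ℕ) : ZMod p) = (2 : ZMod p) ^ 4 - 1 := by push_cast; norm_num
        rw [h', h16, sub_self]
      rw [ZMod.natCast_eq_zero_iff] at h15
      have h35 : p ∣ 3 ∨ p ∣ 5 := (Nat.Prime.dvd_mul hp).mp (by norm_num; exact h15)
      rcases h35 with h | h <;> have := Nat.le_of_dvd (by norm_num) h <;> omega

/-- A generic prime outside BOTH structured families: `19` (`2` is a primitive root mod `19`, while
`19 = 4·q + 1` and `19 = 2·q + 1` have no prime solution `q`).  The generic class is strictly larger
than the summit's structured witnesses. [folklore] -/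
theorem isArtinPrime_nineteen : IsArtinPrime 19 ∧ ¬ (∃ q : ℕ, q.Prime ∧ (19 = 4 * q + 1 ∨ 19 = 2 * q + 1)) := by
  refine ⟨⟨by norm_num, ?_⟩, ?_⟩
  · haveI : Fact (Nat.Prime 19) := ⟨by norm_num⟩
    refine orderOf_eq_of_pow_and_pow_div_prime (by norm_num) (by decide) ?_
    intro ℓ hℓ hℓd
    have hℓ18 : ℓ ≤ 18 := Nat.le_of_dvd (by norm_num) hℓd
    interval_cases ℓ <;> simp_all (config := {decide := true})
  · rintro ⟨q, hq, h | h⟩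
    · omega
    · have : q = 9 := by omega
      subst this
      exact absurd hq (by norm_num)

/-! ## §4 Necessity from Dickson's conjecture (the qualitative `k`-tuple statement) -/

/-- **Dickson ⟹ Artin for the base 2**: the admissible pair `(n, 4n + 1)` is prime infinitely often,
and every such prime `4n + 1` (`n ≥ 3`) is an Artin prime. [cite: CojocaruMurty2005, §10.4, p. 195] -/
theorem artinTwo_of_dickson (hD : DicksonConjecture) : ArtinTwo := by
  have hinf := hD 2 ![1, 4] ![0, 1] (fun i => by fin_cases i <;> simp)
    (fun p hp => by
      by_cases h5 : p = 5
      · subst h5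
        exact ⟨2, by simp [Fin.prod_univ_two]⟩
      · refine ⟨1, ?_⟩
        simp only [Fin.prod_univ_two, Matrix.cons_val_zero, Matrix.cons_val_one]
        norm_num
        intro h
        exact h5 ((Nat.prime_dvd_prime_iff_eq hp (by norm_num)).mp h))
  refine Set.infinite_of_forall_exists_gt fun M => ?_
  have hfreq := (Nat.frequently_atTop_iff_infinite.mpr hinf)
  obtain ⟨n, hMn, hn⟩ := Filter.frequently_atTop.mp hfreq (max M 3 + 1)
  have hn0 : (1 * n + 0).Prime := hn 0
  have hn1 : (4 * n + 1).Prime := hn 1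
  simp only [one_mul, add_zero] at hn0
  refine ⟨4 * n + 1, isArtinPrime_of_four_mul_add_one hn0 (by omega) hn1, by omega⟩


/-! ## §6 The leaf and its upper twin follow from the conjunct (fixed `Ψ` ⟸ size-uniform GHL) -/

/-! ## §7 Necessity of piece A from the leaf, the conjunct, the root and the other conjunct -/

/-- **Leaf-level necessity**: `FixedLower → ArtinTwo`. [this node] -/
theorem artinTwo_of_fixedLower (h : FixedLower) : ArtinTwo :=
  artinTwo_of_dickson (dicksonConjecture_of_fixedLower h)

/-- The STRUCTURED (special) witness family is itself leaf-class: the leaf forces infinitely many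
primes `q` with `4q + 1` prime («as difficult as the twin prime question», Cojocaru–Murty §10.4) — the
piece `ArtinTwo` only remembers the GENERIC class these witnesses certify. [this node] -/
theorem fourMulAddOne_infinite_of_fixedLower (h : FixedLower) :
    {q : ℕ | q.Prime ∧ (4 * q + 1).Prime}.Infinite := by
  have hinf := dicksonConjecture_of_fixedLower h 2 ![1, 4] ![0, 1] (fun i => by fin_cases i <;> simp)
    (fun p hp => by
      by_cases h5 : p = 5
      · subst h5
        exact ⟨2, by simp [Fin.prod_univ_two]⟩
      · refine ⟨1, ?_⟩
        simp only [Fin.prod_univ_two, Matrix.cons_val_zero, Matrix.cons_val_one]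
        norm_num
        intro h
        exact h5 ((Nat.prime_dvd_prime_iff_eq hp (by norm_num)).mp h))
  refine Set.infinite_of_forall_exists_gt fun M => ?_
  obtain ⟨n, hMn, hn⟩ := Filter.frequently_atTop.mp (Nat.frequently_atTop_iff_infinite.mpr hinf) (M + 1)
  have hn0 : (1 * n + 0).Prime := hn 0
  simp only [one_mul, add_zero] at hn0
  exact ⟨n, ⟨hn0, hn 1⟩, by omega⟩

/-- Conjunct-level necessity: `GeneralizedHardyLittlewood → ArtinTwo`. [this node] -/
theorem artinTwo_of_ghl (h : _root_.GeneralizedHardyLittlewood) : ArtinTwo :=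
  artinTwo_of_fixedLower (Summit.Parity.GeneralizedHardyLittlewood.Theses.ShiftedPrimeFactor.fixedLower_of_ghl h)

/-- Root-level necessity: `Parity → ArtinTwo`. [this node] -/
theorem artinTwo_of_parity (h : _root_.Parity) : ArtinTwo := artinTwo_of_ghl h.2

/-- The other conjunct: `BatemanHorn → ArtinTwo` modulo the routine `BatemanHorn → Dickson`
(linear polynomials; hypothesis, as in lens-6's `twoOfThree_of_batemanHorn`). [this node] -/
theorem artinTwo_of_batemanHorn (hBD : BatemanHornConjecture → DicksonConjecture)
    (h : _root_.BatemanHorn) : ArtinTwo :=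
  artinTwo_of_dickson (hBD h)


/-! ## §8 The separating scale: `ArtinTwo` is decided under ERH (Hooley–Lenstra–Moree) -/

/-- **ERH-world certificate.** Under the Extended Riemann Hypothesis piece A is a THEOREM
(Hooley 1967; Lenstra 1977 Thm (8.3); Moree 1999 Thm 2 — the tree's named fact
`lenstra1977_exists_prime_two_primitiveRoot_progression_of_ERH`, here with `M = 8`, `r = 3`), whereas
no hypothesis of GRH type is known to give one prime pair of a fixed pattern (`FixedLower`).
[cite: Hooley1967] [cite: Moree1999, Thm. 2] -/
theorem artinTwo_of_ERH
    (hfact : Literature.NumberTheory.Multiplicative.lenstra1977_exists_prime_two_primitiveRoot_progression_of_ERH)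
    (hERH : Literature.NumberTheory.LFunctions.ExtendedRiemannHypothesis) : ArtinTwo := by
  refine Set.infinite_of_forall_exists_gt fun B => ?_
  obtain ⟨q, hq, hBq, -, hord⟩ := hfact hERH 8 3 B (dvd_refl 8) rfl (by norm_num)
  exact ⟨q, ⟨hq, hord⟩, hBq⟩


/-! ## §9 The node: necessity of R, exactness, deciding theorems -/

/-- `ArtinLift` is literally `ArtinTwo → FixedLower`. [this node] -/
theorem artinLift_iff : ArtinLift ↔ (ArtinTwo → FixedLower) := Iff.rfl

/-- Necessity of the residual (costume branch: it holds whenever the leaf does). [this node] -/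
theorem artinLift_of_fixedLower (h : FixedLower) : ArtinLift := fun _ => h

/-- Trivial branch: the residual holds in any world where piece A fails. [this node] -/
theorem artinLift_of_not_artinTwo (h : ¬ ArtinTwo) : ArtinLift := fun hA => absurd hA h

/-- **Exactness of the node**: `FixedLower ↔ ArtinTwo ∧ ArtinLift`. [this node] -/
theorem fixedLower_iff : FixedLower ↔ ArtinTwo ∧ ArtinLift :=
  ⟨fun h => ⟨artinTwo_of_fixedLower h, artinLift_of_fixedLower h⟩, fun h => h.2 h.1⟩

/-- Glue: pieces ⟹ leaf. [this node] -/
theorem fixedLower_of_pieces (hA : ArtinTwo) (hR : ArtinLift) : FixedLower := hR hA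



/-- Record-level exactness modulo the record's own necessity of `Q` (GHL ⟹ Q: lens-5 `node_iff`
hypothesis, Matomäki–Merikoski 2023); the fixed halves are derived here (`Summit.Parity.GeneralizedHardyLittlewood.Theses.ShiftedPrimeFactor.fixedLower_of_ghl`,
`fixedUpper_of_ghl`, both reused from `Theorems/ShiftedPrimeFactorNecessity.lean`). [this node] -/
theorem node_iff (hQ_of_ghl : _root_.GeneralizedHardyLittlewood → BoundedSiegelZeroQuality) :
    _root_.GeneralizedHardyLittlewood ↔
      BoundedSiegelZeroQuality ∧ FixedUpper ∧ UniformUpperGivenFixed ∧ ArtinTwo ∧ ArtinLift ∧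
        UniformLowerGivenFixed := by
  constructor
  · intro h
    refine ⟨hQ_of_ghl h, Summit.Parity.GeneralizedHardyLittlewood.Theses.ShiftedPrimeFactor.fixedUpper_of_ghl h, fun _ _ => ?_, artinTwo_of_ghl h,
      artinLift_of_fixedLower (Summit.Parity.GeneralizedHardyLittlewood.Theses.ShiftedPrimeFactor.fixedLower_of_ghl h), fun _ _ => ?_⟩
    · intro d t L hd ht ε hε
      obtain ⟨N₀, hN₀⟩ := h d t L hd ht ε hε
      exact ⟨N₀, fun N hN Ψ hΨ hΨL K hK hKN => (abs_sub_le_iff.mp (hN₀ N hN Ψ hΨ hΨL K hK hKN)).1⟩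
    · intro d t L hd ht ε hε
      obtain ⟨N₀, hN₀⟩ := h d t L hd ht ε hε
      exact ⟨N₀, fun N hN Ψ hΨ hΨL K hK hKN => (abs_sub_le_iff.mp (hN₀ N hN Ψ hΨ hΨL K hK hKN)).2⟩
  · rintro ⟨hQ, hFU, hUU, hA, hR, hUL⟩
    exact closes hQ hFU hUU hA hR hUL


end Summit.Parity.GeneralizedHardyLittlewood.ArtinGenericSplitNecessity
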